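import Literature.AnabelianGeometry.EtaleTheta.Discharge.Sec2TemperedCoverDataModel
import HarnessLib

/-!
# [EtTh] Remark 2.6.1 (undotted and once-dotted) as typed over `ThetaCovers.TemperedCoverData`:
# the UNIVERSAL CLOSURES are REFUTED at abc-iut-w5-d118's model (proof-only; FACT-LIST F-0612 / F-0613)

S. Mochizuki, *The étale theta function and its Frobenioid-theoretic manifestations*, Publ. RIMS **45**
(2009) [MochizukiEtTh2009], §2, Remark 2.6.1, PRIMS PDF p. 40 (printed p. 266): "Suppose, for simplicity,
that `K` contains a primitive `l`-th root of unity. Then … `Aut_K(X̲̲^log) = μ_l × {±1}`; `Aut_K(X̲^log) =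
ℤ/lℤ ⋊ {±1}`; `Aut_K(C̲̲^log) = μ_l`; `Aut_K(C̲^log) = {1}`", and, for the once-dotted curves, "the direct
product of the `Aut_K(−)`'s listed above with `Gal(Ċ^log/C^log) ≅ {±1}`" [cite: MochizukiEtTh2009, Rmk 2.6.1 p.40].

abc-iut cell, block C / F (FACT-PROVING WAVE, tranche 144, seat abc-iut-f-144), rows **F-0612**
`ThetaCovers.TemperedCoverData.Rmk261` and **F-0613** `ThetaCovers.TemperedCoverData.Rmk261_dotted`
(abc-iut-L2-t2's `ThetaCoversTempered.lean`; `Aut_K(Z)` is typed as the normaliser quotient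
`autK (tp Π_Z) = N_{Π^tp_C}(Π^tp_Z)/Π^tp_Z`). Both rows are `parametrised` schemata over the abstract
interface `T : TemperedCoverData l` (FACT-LIST rule R5: consumed at NAMED instances; a universal closure is
not a fact). PROOF-ONLY companion (0 definitions): the inhabitant used is abc-iut-w5-d118's model
«Heisenberg ⋊ D_l × Tate `ℤ ⊆ Ẑ`», `G_K = 1` (`ThetaCoversTemperedModelDefs.lean`,
`Discharge/Sec2TemperedCoverDataModelTheta.lean`, `Discharge/Sec2TemperedCoverDataModel.lean`, p430754 /
p430914 / p431045), rebuilt here as the same structure literal inside the proofs.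

WHAT IS PROVED (`l` odd, `l ≠ 1`).
* `PiCuuM_inf_PiXM` — in the model `Π_{X̲̲} = Π_{C̲̲} ∩ Π_X = E = Φ⁻¹((ℤ/l × ℤ/l) ⋊ 1) ∩ Ker Ψ`;
  `mem_tpPiXuuM_iff`, `tpPiXuuM_eq_ker` — its tempered trace `Π^tp_{X̲̲} = Π_{X̲̲} ∩ Π^tp_C` is the kernel of
  `Π^tp_C = A × ℤ ↠ D_l × ℤ/l`, hence NORMAL in `Π^tp_C` of index `2l · l` (`index_tpPiXuuM`); and
  `Π^tp_{Ẋ̲̲} = Π^tp_{X̲̲} ∩ Π^tp_Ċ` is the kernel of `Π^tp_C ↠ (D_l × ℤ/2) × ℤ/l`, normal of index `2l · 2 · l`.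
* `TemperedCoverData.natCard_autK_eq_index` — for a NORMAL `S ⊴ Π^tp_C`, `#(autK S) = [Π^tp_C : S]` (pure
  group theory over the interface).
* `exists_model_autK` — the model with its two `Aut_K`-cardinalities computed:
  `#Aut_K(X̲̲) = #(N(Π^tp_{X̲̲})/Π^tp_{X̲̲}) = 2l²` and `#Aut_K(Ẋ̲̲) = 4l²`, while `K ⊇ μ_l` (`HasMuL`) holds.
* **`not_forall_rmk261`**, **`not_forall_rmk261_dotted`** — the universal closures of the typed rows FAIL:
  the `X̲̲`-clause of `Rmk261` demands `#Aut_K(X̲̲) = #(ℤ/l × ℤ/2) = 2l ≠ 2l²`, the `Ẋ̲̲`-clause of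
  `Rmk261_dotted` demands `4l ≠ 4l²`.

READING (independence certificate for GAP-LEDGER **G-L2d3-1**): abc-iut-L2-d3's discharges `rmk261_of`
(p419607) / `rmk261_dotted_of` (p414899) take the binder `hΘ : ⁅Δ_X, Δ_X⁆ · Ker = Δ̄_Θ`-preimage — the printed
DEFINITION "`Δ_Θ := Im(∧² Δ^ab_X)`" (p. 35), not a field of `CoverData`. At this model `Δ̄_Θ` is the Tate
direction `Ẑ/lẐ`, commutators of `Δ_X` die in it, `hΘ` fails, and so does the typed Remark: `hΘ` is NOT
derivable from the interface `ThetaCovers.TemperedCoverData` as typed (the v-next field S2-3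
`commutator_sup_barKer` of the 13:00Z census is genuinely needed for interface-level consumers; at
setting-born cover data it is a theorem, abc-iut-L2-t11 R158). The `C̲̲`- and `C̲`-clauses do hold at the model
(not needed here).

HONEST FRAMING: statements about the cell's own typing of a refereed [EtTh] remark over an abstract
interface, evaluated at a DEGENERATE consistency witness (`G_K = 1`, finite Heisenberg part) — not the
tempered fundamental group of a curve; the printed Remark 2.6.1 is neither refuted nor proved here; a FACT
row is an assumption label, not an endorsement; nothing bears on [IUTchIII] Cor. 3.12; no side is taken;
typed ≠ proved.
-/

noncomputable section

namespace Literature.AnabelianGeometry.EtaleTheta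

namespace ThetaCovers

/-! ## 1. `#(N(S)/S) = [G : S]` for a normal subgroup (interface-level group theory) -/

namespace TemperedCoverData

universe u

variable {l : ℕ} (T : TemperedCoverData.{u} l)

/-- For a NORMAL subgroup `S ⊴ Π^tp_C` the normaliser is everything, so the `Aut_K`-quotient
`autK S = N_{Π^tp_C}(S)/S` has cardinality the index `[Π^tp_C : S]` (`0` if infinite).
[cite: MochizukiEtTh2009, Rmk 2.6.1 p.40] -/
theorem natCard_autK_eq_index (S : Subgroup T.Gtp) [S.Normal] : Nat.card (T.autK S) = S.index := by
  have h1 : Nat.card (T.autK S) = S.relIndex (Subgroup.normalizer (S : Set T.Gtp)) :=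
    (Subgroup.index_eq_card _).symm
  rw [h1, Subgroup.normalizer_eq_top, Subgroup.relIndex_top_right]

end TemperedCoverData

/-! ## 2. The model's `Π_{X̲̲}`, `Π^tp_{X̲̲}`, `Π^tp_{Ẋ̲̲}` -/

namespace TemperedModel

open Multiplicative HeisenbergWitness Literature.AnabelianGeometry.SemiGraphs
  Literature.AnabelianGeometry.EtaleTheta.SettingModel

variable (l : ℕ) [NeZero l]

/-- `Π_{C̲̲} ⊆ Ker Ψ` in the model (`Ker`, `E ⊆ Ker Ψ` by definition, `Ψ ι̲ = 1`): the whole of `Π_{C̲̲}` lies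
in the `l`-divisible Tate direction. (toy bookkeeping) [cite: MochizukiEtTh2009, Def 2.3 p.38] -/
theorem PiCuuM_le_ker_Psi : PiCuuM l ≤ (Psi l).ker := by
  refine sup_le (sup_le inf_le_right inf_le_right) ?_
  rw [Subgroup.zpowers_le, MonoidHom.mem_ker, Psi_iotaM]

/-- **`Π_{X̲̲} = Π_{C̲̲} ∩ Π_X = E`** in the model (`E = (Π_{C̲} ∩ Π_X) ∩ Ker Ψ = Φ⁻¹((ℤ/l × ℤ/l) ⋊ 1) ∩ Ker Ψ`;
`Π_{C̲̲} ⊆ Π_{C̲}`, `Π_{C̲̲} ⊆ Ker Ψ`). (toy bookkeeping) [cite: MochizukiEtTh2009, Def 2.3 p.38] -/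
theorem PiCuuM_inf_PiXM : PiCuuM l ⊓ PiXM l = EM l := by
  refine le_antisymm (fun x hx => ?_) ?_
  · exact ⟨⟨PiCuuM_le_HpM l hx.1, hx.2⟩, PiCuuM_le_ker_Psi l hx.1⟩
  · exact le_inf (le_sup_right.trans le_sup_left) (inf_le_left.trans inf_le_right)

/-- Membership in `E`: the `D_l`-component of `Φ` is trivial and `Ψ = 1`. (toy bookkeeping)
[cite: MochizukiEtTh2009, Prop 2.2 (i) p.37] -/
theorem mem_EM_iff (x : PiCM l) : x ∈ EM l ↔ (Phi l x).right = 1 ∧ Psi l x = 1 := by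
  rw [EM, Subgroup.mem_inf, mem_HpM_inf_iff, MonoidHom.mem_ker]

/-- **Membership in `Π^tp_{X̲̲} = Π_{X̲̲} ∩ Π^tp_C`** (`Π^tp_C = A × ℤ`, `A = heisPiC l × ℤ/2`): the Heisenberg
component has trivial `D_l`-part and the `ℤ`-coordinate is divisible by `l`. (toy bookkeeping)
[cite: MochizukiEtTh2009, Def 2.5 p.39] -/
theorem mem_tpPiXuuM_iff (a : TA l) (n : Multiplicative ℤ) :
    (a, n) ∈ (PiCuuM l ⊓ PiXM l).comap (toHatM l).toMonoidHom ↔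
      (TA.heis l a).right = 1 ∧ ((toAdd n : ℤ) : ZMod l) = 0 := by
  rw [PiCuuM_inf_PiXM, Subgroup.mem_comap]
  change toHatM l (a, n) ∈ EM l ↔ _
  rw [mem_EM_iff, toHatM_apply, Phi_eta, Psi_eta, ofAdd_eq_one]
  exact Iff.rfl

omit [NeZero l] in
/-- `Π^tp_C = A × ℤ ↠ D_l × ℤ/l`, `((h, t), n) ↦ (h.right, n mod l)` is surjective. (toy bookkeeping)
[cite: MochizukiEtTh2009, Def 2.5 p.39] -/
theorem prodMap_rightHom_cast_surjective : Function.Surjective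
    ((SemidirectProduct.rightHom.comp (TA.heis l)).prodMap
      (AddMonoidHom.toMultiplicative (Int.castAddHom (ZMod l)))) := by
  rw [MonoidHom.coe_prodMap]
  refine Function.Surjective.prodMap ?_ ?_
  · exact SemidirectProduct.rightHom_surjective.comp fun h => ⟨TA.mk l h 1, rfl⟩
  · intro y
    obtain ⟨k, hk⟩ := ZMod.intCast_surjective (toAdd y)
    refine ⟨ofAdd k, ?_⟩
    change ofAdd ((k : ℤ) : ZMod l) = y
    rw [hk, ofAdd_toAdd]

/-- **`Π^tp_{X̲̲}` is the kernel of `Π^tp_C ↠ D_l × ℤ/l`.** (toy bookkeeping) [cite: MochizukiEtTh2009, Def 2.5 p.39] -/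
theorem tpPiXuuM_eq_ker : (PiCuuM l ⊓ PiXM l).comap (toHatM l).toMonoidHom =
    ((SemidirectProduct.rightHom.comp (TA.heis l)).prodMap
      (AddMonoidHom.toMultiplicative (Int.castAddHom (ZMod l)))).ker := by
  ext ⟨a, n⟩
  rw [mem_tpPiXuuM_iff, MonoidHom.mem_ker]
  change _ ↔ ((SemidirectProduct.rightHom (TA.heis l a), ofAdd (((toAdd n : ℤ) : ZMod l))) :
    DihedralGroup l × Multiplicative (ZMod l)) = 1
  rw [Prod.mk_eq_one, SemidirectProduct.rightHom_eq_right, ofAdd_eq_one]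

/-- `Π^tp_{X̲̲}` is NORMAL in `Π^tp_C` (a kernel). (toy bookkeeping) [cite: MochizukiEtTh2009, Rmk 2.6.1 p.40] -/
theorem tpPiXuuM_normal : ((PiCuuM l ⊓ PiXM l).comap (toHatM l).toMonoidHom).Normal := by
  rw [tpPiXuuM_eq_ker]
  exact MonoidHom.normal_ker _

/-- **`[Π^tp_C : Π^tp_{X̲̲}] = 2l · l`** (`#D_l · #ℤ/l`). (toy bookkeeping) [cite: MochizukiEtTh2009, Rmk 2.6.1 p.40] -/
theorem index_tpPiXuuM : ((PiCuuM l ⊓ PiXM l).comap (toHatM l).toMonoidHom).index = 2 * l * l := by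
  rw [tpPiXuuM_eq_ker, Subgroup.index_ker, MonoidHom.range_eq_top.mpr (prodMap_rightHom_cast_surjective l),
    Subgroup.card_top, Nat.card_prod, DihedralGroup.nat_card, Nat.card_eq_fintype_card,
    Fintype.card_multiplicative, ZMod.card]

omit [NeZero l] in
/-- `Π^tp_C = A × ℤ ↠ (D_l × ℤ/2) × ℤ/l`, `((h, t), n) ↦ ((h.right, t), n mod l)` is surjective. (toy bookkeeping)
[cite: MochizukiEtTh2009, Def 2.5 p.39] -/
theorem prodMap_rightHom_two_cast_surjective : Function.Surjective
    (((SemidirectProduct.rightHom.comp (TA.heis l)).prod (TA.two l)).prodMap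
      (AddMonoidHom.toMultiplicative (Int.castAddHom (ZMod l)))) := by
  rw [MonoidHom.coe_prodMap]
  refine Function.Surjective.prodMap ?_ ?_
  · rintro ⟨d, t⟩
    obtain ⟨h, hh⟩ := SemidirectProduct.rightHom_surjective (N := Multiplicative (ZMod l × ZMod l))
      (φ := theta l) d
    exact ⟨TA.mk l h t, Prod.ext hh rfl⟩
  · intro y
    obtain ⟨k, hk⟩ := ZMod.intCast_surjective (toAdd y)
    refine ⟨ofAdd k, ?_⟩
    change ofAdd ((k : ℤ) : ZMod l) = y
    rw [hk, ofAdd_toAdd]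

/-- **`Π^tp_{Ẋ̲̲} = Π^tp_{X̲̲} ∩ Π^tp_Ċ` is the kernel of `Π^tp_C ↠ (D_l × ℤ/2) × ℤ/l`** (`Π^tp_Ċ = Ker(ℤ/2-coordinate) × ℤ`).
(toy bookkeeping) [cite: MochizukiEtTh2009, Def 2.5 (ii) p.39] -/
theorem tpPiXuuM_inf_PiCdot_eq_ker :
    (PiCuuM l ⊓ PiXM l).comap (toHatM l).toMonoidHom ⊓ ((TA.two l).ker).prod ⊤ =
    ((((SemidirectProduct.rightHom.comp (TA.heis l)).prod (TA.two l)).prodMap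
      (AddMonoidHom.toMultiplicative (Int.castAddHom (ZMod l)))).ker) := by
  ext ⟨a, n⟩
  rw [Subgroup.mem_inf, mem_tpPiXuuM_iff, Subgroup.mem_prod, MonoidHom.mem_ker, MonoidHom.mem_ker]
  change _ ∧ TA.two l a = 1 ∧ n ∈ (⊤ : Subgroup (Multiplicative ℤ)) ↔
    (((SemidirectProduct.rightHom (TA.heis l a), TA.two l a), ofAdd (((toAdd n : ℤ) : ZMod l))) :
      (DihedralGroup l × Multiplicative (ZMod 2)) × Multiplicative (ZMod l)) = 1
  rw [Prod.mk_eq_one, Prod.mk_eq_one, SemidirectProduct.rightHom_eq_right, ofAdd_eq_one]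
  exact ⟨fun h => ⟨⟨h.1.1, h.2.1⟩, h.1.2⟩, fun h => ⟨⟨h.1.1, h.2⟩, h.1.2, trivial⟩⟩

/-- `Π^tp_{Ẋ̲̲}` is NORMAL in `Π^tp_C`. (toy bookkeeping) [cite: MochizukiEtTh2009, Rmk 2.6.1 p.40] -/
theorem tpPiXuuM_inf_PiCdot_normal :
    ((PiCuuM l ⊓ PiXM l).comap (toHatM l).toMonoidHom ⊓ ((TA.two l).ker).prod ⊤).Normal := by
  rw [tpPiXuuM_inf_PiCdot_eq_ker]
  exact MonoidHom.normal_ker _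

/-- **`[Π^tp_C : Π^tp_{Ẋ̲̲}] = 2l · 2 · l`.** (toy bookkeeping) [cite: MochizukiEtTh2009, Rmk 2.6.1 p.40] -/
theorem index_tpPiXuuM_inf_PiCdot :
    ((PiCuuM l ⊓ PiXM l).comap (toHatM l).toMonoidHom ⊓ ((TA.two l).ker).prod ⊤).index = 2 * l * 2 * l := by
  rw [tpPiXuuM_inf_PiCdot_eq_ker, Subgroup.index_ker,
    MonoidHom.range_eq_top.mpr (prodMap_rightHom_two_cast_surjective l), Subgroup.card_top, Nat.card_prod,
    Nat.card_prod, DihedralGroup.nat_card, Nat.card_eq_fintype_card, Fintype.card_multiplicative, ZMod.card,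
    Nat.card_eq_fintype_card, Fintype.card_multiplicative, ZMod.card]

/-! ## 3. The model with its `Aut_K(X̲̲)`, `Aut_K(Ẋ̲̲)` computed, and the refutations -/

/-- **abc-iut-w5-d118's model of `TemperedCoverData`, with `#Aut_K(X̲̲)` and `#Aut_K(Ẋ̲̲)` computed**: for every odd
`l` there is a `T : TemperedCoverData l` (the structure literal of `TemperedModel.exists_model`, p431045) at which
`K ⊇ μ_l` (`HasMuL`) holds, `#(N(Π^tp_{X̲̲})/Π^tp_{X̲̲}) = 2l²` and `#(N(Π^tp_{Ẋ̲̲})/Π^tp_{Ẋ̲̲}) = 4l²` (both subgroups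
are normal in `Π^tp_C = A × ℤ`). [cite: MochizukiEtTh2009, Rmk 2.6.1 p.40] -/
theorem exists_model_autK (hl : Odd l) : ∃ T : TemperedCoverData.{0} l,
    T.HasMuL ∧ Nat.card (T.autK (T.tp T.PiXuu)) = 2 * l * l ∧
      Nat.card (T.autK (T.tp T.PiXuu ⊓ T.PiCdot)) = 2 * l * 2 * l := by
  haveI := TAX_normal l
  haveI : ((TAX l).prod (⊥ : Subgroup (Multiplicative ℤ))).Normal := Subgroup.prod_normal _ _
  let T : TemperedCoverData.{0} l :=
    { toCoverDataAx := coverDataAx l hl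
      PiCuu := PiCuuM l
      isTypeLTorsThetaPm := isTypeLTorsThetaPm_PiCuuM l hl
      isOpen_PiCuu' := isOpen_PiCuuM l
      Gtp := GtpM l
      toHat := (toHatM l).toMonoidHom
      continuous_toHat := (toHatM l).continuous
      injective_toHat := toHatM_injective l
      isProfiniteCompletion_toHat := isProfiniteCompletion_prodMap_etaCont (TA l) (Multiplicative ℤ)
      PiYtp := (TAX l).prod ⊥
      PiYtp_le := by
        change (TAX l).prod ⊥ ≤ (PiXM l).comap (toHatM l).toMonoidHom
        rw [comap_toHatM_PiXM]
        exact Subgroup.prod_mono le_rfl bot_le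
      PiYtp_normal := inferInstance
      isOpen_PiYtp := isOpen_discrete _
      quotZ := nonempty_quotZ l
      PiYddtp := ((TAX l ⊓ (TA.two l).ker)).prod ⊥
      PiYddtp_le := Subgroup.prod_mono inf_le_left le_rfl
      isOpen_PiYddtp := isOpen_discrete _
      relIndex_PiYddtp := relIndex_PiYddtp l
      PiCdot := ((TA.two l).ker).prod ⊤
      index_PiCdot := index_PiCdot l
      isOpen_PiCdot := isOpen_discrete _
      PiCdot_ne := PiCdot_ne l }
  have hXuu : T.tp T.PiXuu = (PiCuuM l ⊓ PiXM l).comap (toHatM l).toMonoidHom := rfl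
  have hXuuD : T.tp T.PiXuu ⊓ T.PiCdot =
      (PiCuuM l ⊓ PiXM l).comap (toHatM l).toMonoidHom ⊓ ((TA.two l).ker).prod ⊤ := rfl
  haveI h1 : (T.tp T.PiXuu).Normal := by rw [hXuu]; exact tpPiXuuM_normal l
  haveI h2 : (T.tp T.PiXuu ⊓ T.PiCdot).Normal := by rw [hXuuD]; exact tpPiXuuM_inf_PiCdot_normal l
  refine ⟨T, fun c t ht => hasMuL_model l hl c ht, ?_, ?_⟩
  · rw [T.natCard_autK_eq_index, hXuu, index_tpPiXuuM]
  · rw [T.natCard_autK_eq_index, hXuuD, index_tpPiXuuM_inf_PiCdot]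

/-- **The universal closure of the typed [EtTh] Remark 2.6.1 (`TemperedCoverData.Rmk261`, FACT-LIST F-0612) is
FALSE**: at the model (`l` odd, `l ≠ 1`, `K ⊇ μ_l` holds) `#Aut_K(X̲̲) = 2l² ≠ 2l = #(μ_l × {±1})`, so the
`X̲̲`-clause fails. INDEPENDENCE CERTIFICATE for GAP-LEDGER G-L2d3-1: the binder `hΘ` of `rmk261_of` is not
derivable from the interface. Nothing printed is refuted. [cite: MochizukiEtTh2009, Rmk 2.6.1 p.40] -/
theorem not_forall_rmk261 (hl : Odd l) (hl1 : l ≠ 1) : ¬ ∀ T : TemperedCoverData.{0} l, T.Rmk261 := by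
  obtain ⟨T, hmu, hcard, -⟩ := exists_model_autK l hl
  intro h
  obtain ⟨⟨e⟩, -, -, -⟩ := h T hmu
  have h2 : Nat.card (T.autK (T.tp T.PiXuu)) = l * 2 := by
    rw [Nat.card_congr e.toEquiv, Nat.card_prod]
    simp only [Nat.card_eq_fintype_card, Fintype.card_multiplicative, ZMod.card]
  rw [hcard] at h2
  have hl0 : 0 < 2 * l := by have := NeZero.ne l; omega
  have : 2 * l * l = 2 * l * 1 := by rw [h2]; ring
  exact hl1 (Nat.eq_of_mul_eq_mul_left hl0 this)

/-- **The universal closure of the typed once-dotted Remark 2.6.1 (`TemperedCoverData.Rmk261_dotted`, FACT-LIST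
F-0613) is FALSE**: at the model `#Aut_K(Ẋ̲̲) = 4l² ≠ 4l = #((μ_l × {±1}) × {±1})`, so the `Ẋ̲̲`-clause fails.
Nothing printed is refuted. [cite: MochizukiEtTh2009, Rmk 2.6.1 p.40] -/
theorem not_forall_rmk261_dotted (hl : Odd l) (hl1 : l ≠ 1) :
    ¬ ∀ T : TemperedCoverData.{0} l, T.Rmk261_dotted := by
  obtain ⟨T, hmu, -, hcard⟩ := exists_model_autK l hl
  intro h
  obtain ⟨⟨e⟩, -, -, -⟩ := h T hmu
  have h2 : Nat.card (T.autK (T.tp T.PiXuu ⊓ T.PiCdot)) = l * 2 * 2 := by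
    rw [Nat.card_congr e.toEquiv, Nat.card_prod, Nat.card_prod]
    simp only [Nat.card_eq_fintype_card, Fintype.card_multiplicative, ZMod.card]
  rw [hcard] at h2
  have hl0 : 0 < 4 * l := by have := NeZero.ne l; omega
  have : 4 * l * l = 4 * l * 1 := by
    have e1 : 2 * l * 2 * l = 4 * l * l := by ring
    rw [← e1, h2]; ring
  exact hl1 (Nat.eq_of_mul_eq_mul_left hl0 this)

end TemperedModel

end ThetaCovers

end Literature.AnabelianGeometry.EtaleTheta

end
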